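import Summits.QuantumFields.BalabanUV.T4Continuum.Support.RegionGaugeFixedVectorFlat

/-!
# `BalabanUV.T4Continuum.Support.RegionStarLineGauge` — NE2 (node U1a) formalisation swarm, SUPPLIER item «Δ1-COERC-ORTH-LINE» under the
# owner's sub-row `T4-U1a.S-NE2-D1-DIRICHLET°` (vector layer, W1): THE `e`-LINE GAUGE WITH DIRICHLET EXTERIOR — an explicit Dirichlet gauge
# potential for a star-bond field, built by integrating the field along the lattice lines of one direction `e` from the exterior site in
# front of each block, with the line mismatch spread evenly; its residual is computed EXACTLY: `ℓ/(n+1)` on every `e`-bond of a line and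
# «partial curl sums along the line» on every transverse bond whose line data are anchored at vanishing exterior tangential bonds
# (unit b2b-balaban-t4-ne2-formalise-leaf-09, gen 9, v1)

HONEST FRAMING (T4-DAG p. 1).  [folklore] `U = 1` lattice calculus on the fine torus `Π_μ ℤ/(n·M_μ)` tiled by unit blocks; IDENTITIES only
(no estimate, no region hypothesis yet — the vanishing of the two anchoring tangential bonds is a HYPOTHESIS of the transverse identity here,
discharged for `e`-thin block sets in the sequel `RegionStarLineGaugeRegion`); nothing printed is a hypothesis; NE2 (U1a) NOT proved; spine
PROVED 0/9 unchanged; NOT [B9] (3.23)–(3.27) as printed; NOT infinite volume, NOT the mass gap, NOT Clay.  HONEST DEPENDENCY (verbatim):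
«continuum YM on T⁴ ⇐ BetaPertH ∧ nine spine estimates (0/9 proved); BetaPertH ⇐ (D1) ∧ (D4) ∧ CAP+tail; G-an2-4 gates asym, D1 and NE2/3/4.»

WHY (memo `t4/T4-EST-NE2-D1-COERC-ORTH.md` §2–§4).  By `RegionGaugeOrbit.orthSlice_of_gaugePoincare` the located open estimate W1 of the
vector layer follows for a block set `S` as soon as every star-bond field `A` admits SOME Dirichlet scalar `μ` on `Ω` with
`nsq (A − ∂_Ω μ) ≤ C₁·nsq (curlR A) + C₂·n^d·nsq (avgR A)`.  The candidate `μ` of this lineage is the LINE GAUGE: on the block-line through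
`x` in direction `e` (sites `xstart x + s·e`, `s = 1, …, n`, of the block of `x`; exterior start `xstart x`, the last site of the preceding block)
integrate the `e`-component of the field from the start, `n·μ₀(x) = Σ_{s ≤ edig x} Z(xstart x + s·e, e)`, and subtract the evenly spread line
mismatch `ℓ(x) = Σ_{s ≤ n} Z(xstart x + s·e, e)` (the `n + 1` `e`-bonds from the start site to the first site of the next block):
`μ(x) = μ₀(x) − (edig x + 1)/(n(n+1))·ℓ(x)`.

WHAT THIS FILE PROVES (0 sorry; all statements for an ARBITRARY torus field `Z` — the region enters only in the sequel):
 * §1 GEOMETRY OF `e`-LINES in the digit chart `x = n·y + j` ([B5] (1.6)): `edig`, `xstart`, `xstart_bpt` (`= n·(y − e) + j[e ↦ n−1]`), the line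
   sites `xstart_bpt_add_tstep_succ` (`= n·y + j[e ↦ s]`), the end `xstart_bpt_add_tstep_end` (first site of block `y + e`), the moves along the
   line (`edig_add_unitVec_e`, `xstart_add_unitVec_e`) and across it (`edig_add_unitVec_ne`, `xstart_add_unitVec_ne`: a transverse step translates the line).
 * §2 THE LINE GAUGE `pathSum`, `ell`, `muT` and its `e`-RESIDUALS, exactly: **`res_e_interior`** (`Z(x,e) − n(μ(x+e) − μ(x)) = ℓ(x)/(n+1)`),
   **`res_e_last`** (`Z(x,e) + n·μ(x) = ℓ(x)/(n+1)`, Dirichlet zero beyond), **`res_e_first`** (`Z(xstart x′, e) − n·μ(x′) = ℓ(x′)/(n+1)`).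
 * §3 THE TRANSVERSE RESIDUAL: the plaquette telescoping **`tele_line`**, **`ell_add_unitVec_ne`** (`ℓ(x + e_ν) − ℓ(x) = −n⁻¹·curlSum x (n+1)`)
   and **`res_nu`**: if the two ANCHORING tangential bonds `(xstart x, ν)`, `(xstart x + (n+1)·e, ν)` carry no field, then for `ν ≠ e`
   `Z(x,ν) − n(μ(x + e_ν) − μ(x)) = n⁻¹·curlSum x (edig x + 1) − (edig x + 1)/(n(n+1))·curlSum x (n+1)`, `curlSum x k = Σ_{s<k} F_{eν}(xstart x + s·e)`
   — partial curl sums along the line, nothing else («in the axial gauge the potential is the line integral of the field strength»).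

ABSOLUTE RULE (cell, verbatim): «No internally-minted statement may enter as a cited fact. Every hypothesis is either kernel-proved in
this package or a verbatim quotation of a PUBLISHED theorem with page reference. The manuscript(s) under audit are NOT citable for
their own disputed steps — they are the thing under adjudication; programme-internal (2001/route/tribunal) claims are never citable.»
[folklore] throughout; data defs `edig`, `xstart`, `pathSum`, `ell`, `muT`; no `def … : Prop`.  NOT CLAIMED: any estimate; W1; NE2; NE3;
«not in print; our construction».
-/

noncomputable section

open scoped BigOperators ComplexConjugate Matrix
open Finset

namespace Summit.QuantumFields.BalabanUV.T4Continuum.RegionStarLineGauge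

open Literature.MathematicalPhysics.QuantumFieldTheory.Balaban1983to89.B5Prop11Plancherel (Tor fine unitVec)
open Literature.MathematicalPhysics.QuantumFieldTheory.Balaban1983to89.B5Action121 (Fs Fs_apply)
open Literature.MathematicalPhysics.QuantumFieldTheory.Balaban1983to89.B5Block118 (bpt tstep tstep_zero tstep_succ bpt_add_tstep)
open Literature.MathematicalPhysics.QuantumFieldTheory.Balaban1983to89.B5Blocks16 (blockOf blockOf_bpt)
open Summit.QuantumFields.BalabanUV.T4Continuum
open Summit.QuantumFields.BalabanUV.T4Continuum.ScalarBlockTrialFunction (digits digits_bpt bpt_add_unitVec_of_lt bpt_add_unitVec_of_eq bpt_update')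
open Summit.QuantumFields.BalabanUV.T4Continuum.RegionGaugeFixedVectorFlat (bpt_blockOf_digits)
open Summit.QuantumFields.BalabanUV.Beta.GAN24.DirichletBoxTrace (bpt_update_add_tstep bpt_eq_update_add)

variable {d : ℕ} (n : ℕ) [NeZero n] (M : Fin d → ℕ) [hM : ∀ μ, NeZero (M μ)] (e : Fin d)

/-! ## §1 Geometry of `e`-lines in the digit chart -/

/-- the `e`-DIGIT of a fine site (its position `0 ≤ t < n` on the block-line in direction `e`). [folklore] -/
def edig (x : Tor (fine n M)) : ℕ := (digits n M x e : ℕ)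

/-- `edig x < n`. [folklore] -/
theorem edig_lt (x : Tor (fine n M)) : edig n M e x < n := (digits n M x e).isLt

/-- the EXTERIOR START SITE of the block-line through `x`: `x − (edig x + 1)·e`, the last site of the preceding block. [folklore] -/
def xstart (x : Tor (fine n M)) : Tor (fine n M) := x - tstep (fine n M) e (edig n M e x + 1)

/-- `xstart x + (edig x + 1)·e = x`. [folklore] -/
theorem xstart_add (x : Tor (fine n M)) : xstart n M e x + tstep (fine n M) e (edig n M e x + 1) = x := by
  rw [xstart, sub_add_cancel]

omit [NeZero n] hM in
/-- `tstep` is additive. [folklore] -/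
theorem tstep_add (a b : ℕ) : tstep (fine n M) e (a + b) = tstep (fine n M) e a + tstep (fine n M) e b := by
  induction b with
  | zero => rw [add_zero, tstep_zero, add_zero]
  | succ b ih => rw [← add_assoc, tstep_succ, ih, tstep_succ, add_assoc]

omit [NeZero n] hM in
/-- `1·e = e`. [folklore] -/
theorem tstep_one : tstep (fine n M) e 1 = unitVec (fine n M) e := by
  rw [show (1 : ℕ) = 0 + 1 from rfl, tstep_succ, tstep_zero, zero_add]

/-- in the chart: `edig (n·y + j) = j_e`. [folklore] -/
theorem edig_bpt (y : Tor M) (j : Fin d → Fin n) : edig n M e (bpt n M y j) = (j e : ℕ) := by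
  rw [edig, digits_bpt]

/-- the last digit `n − 1`. [folklore] -/
def lastD : Fin n := ⟨n - 1, Nat.sub_lt (Nat.pos_of_ne_zero (NeZero.ne n)) Nat.one_pos⟩

omit hM in
/-- the first site of block `y` on the line of `j`, stepped back once, is the last site of block `y − e` on that line. [folklore] -/
theorem bpt_update_zero_eq (y : Tor M) (j : Fin d → Fin n) :
    bpt n M y (Function.update j e 0) = bpt n M (y - unitVec M e) (Function.update j e (lastD n)) + unitVec (fine n M) e := by
  have h : ((Function.update j e (lastD n)) e : ℕ) + 1 = n := by
    rw [Function.update_self]; show n - 1 + 1 = n; have := Nat.pos_of_ne_zero (NeZero.ne n); omega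
  rw [bpt_add_unitVec_of_eq n M (y - unitVec M e) _ e h, sub_add_cancel, Function.update_idem]

/-- **the start site in the chart**: `xstart (n·y + j) = n·(y − e) + j[e ↦ n−1]`. [folklore] -/
theorem xstart_bpt (y : Tor M) (j : Fin d → Fin n) :
    xstart n M e (bpt n M y j) = bpt n M (y - unitVec M e) (Function.update j e (lastD n)) := by
  rw [xstart, edig_bpt, sub_eq_iff_eq_add, tstep_succ, bpt_eq_update_add n M y j e, bpt_update_zero_eq]
  abel

/-- `blockOf (xstart x) = blockOf x − e`. [folklore] -/
theorem blockOf_xstart (x : Tor (fine n M)) : blockOf n M (xstart n M e x) = blockOf n M x - unitVec M e := by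
  conv_lhs => rw [← bpt_blockOf_digits n M x, xstart_bpt, blockOf_bpt]

/-- **the line sites in the chart**: `xstart (n·y + j) + (s+1)·e = n·y + j[e ↦ s]` for `s < n`. [folklore] -/
theorem xstart_bpt_add_tstep_succ (y : Tor M) (j : Fin d → Fin n) {s : ℕ} (hs : s < n) :
    xstart n M e (bpt n M y j) + tstep (fine n M) e (s + 1) = bpt n M y (Function.update j e ⟨s, hs⟩) := by
  rw [xstart_bpt, add_comm s 1, tstep_add, tstep_one, ← add_assoc, ← bpt_update_zero_eq,
    bpt_update_add_tstep n M y j e ⟨s, hs⟩]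

/-- the line sites lie in the block of `x`: `blockOf (xstart x + (s+1)·e) = blockOf x` for `s < n`. [folklore] -/
theorem blockOf_xstart_add_tstep_succ (x : Tor (fine n M)) {s : ℕ} (hs : s < n) :
    blockOf n M (xstart n M e x + tstep (fine n M) e (s + 1)) = blockOf n M x := by
  conv_lhs => rw [← bpt_blockOf_digits n M x, xstart_bpt_add_tstep_succ n M e _ _ hs, blockOf_bpt]

/-- **the end of the line**: `xstart (n·y + j) + (n+1)·e = n·(y + e) + j[e ↦ 0]`, the first site of the next block. [folklore] -/
theorem xstart_bpt_add_tstep_end (y : Tor M) (j : Fin d → Fin n) :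
    xstart n M e (bpt n M y j) + tstep (fine n M) e (n + 1) = bpt n M (y + unitVec M e) (Function.update j e 0) := by
  have hn : 0 < n := Nat.pos_of_ne_zero (NeZero.ne n)
  obtain ⟨m, hm⟩ : ∃ m, n = m + 1 := ⟨n - 1, by omega⟩
  have hm' : m < n := by omega
  rw [show n + 1 = (m + 1) + 1 by rw [hm], tstep_succ, ← add_assoc, xstart_bpt_add_tstep_succ n M e y j hm',
    bpt_add_unitVec_of_eq n M y _ e (by rw [Function.update_self]; exact hm.symm), Function.update_idem]

/-- `blockOf (xstart x + (n+1)·e) = blockOf x + e`. [folklore] -/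
theorem blockOf_xstart_add_tstep_end (x : Tor (fine n M)) :
    blockOf n M (xstart n M e x + tstep (fine n M) e (n + 1)) = blockOf n M x + unitVec M e := by
  conv_lhs => rw [← bpt_blockOf_digits n M x, xstart_bpt_add_tstep_end, blockOf_bpt]

/-- **moving along the line**: for `edig x + 1 < n`, `edig (x + e) = edig x + 1` … [folklore] -/
theorem edig_add_unitVec_e (x : Tor (fine n M)) (h : edig n M e x + 1 < n) :
    edig n M e (x + unitVec (fine n M) e) = edig n M e x + 1 := by
  have hx := bpt_blockOf_digits n M x
  have h' : ((digits n M x) e : ℕ) + 1 < n := h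
  conv_lhs => rw [← hx, bpt_add_unitVec_of_lt n M _ _ e h']
  rw [edig_bpt, Function.update_self]
  rfl

/-- … and `xstart (x + e) = xstart x`. [folklore] -/
theorem xstart_add_unitVec_e (x : Tor (fine n M)) (h : edig n M e x + 1 < n) :
    xstart n M e (x + unitVec (fine n M) e) = xstart n M e x := by
  rw [xstart, edig_add_unitVec_e n M e x h, xstart, tstep_succ _ _ (edig n M e x + 1)]
  abel

/-- at the last site (`edig x + 1 = n`), `x + e` is the end of the line. [folklore] -/
theorem add_unitVec_e_eq_end (x : Tor (fine n M)) (h : edig n M e x + 1 = n) :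
    x + unitVec (fine n M) e = xstart n M e x + tstep (fine n M) e (n + 1) := by
  conv_lhs => rw [← xstart_add n M e x]
  rw [h, tstep_succ _ _ n, add_assoc]

/-- **a transverse unit step translates the line**: for `ν ≠ e`, `edig (x + e_ν) = edig x` … [folklore] -/
theorem edig_add_unitVec_ne (x : Tor (fine n M)) {ν : Fin d} (hν : ν ≠ e) :
    edig n M e (x + unitVec (fine n M) ν) = edig n M e x := by
  have hx := bpt_blockOf_digits n M x
  set y := blockOf n M x
  set j := digits n M x
  by_cases h : (j ν : ℕ) + 1 < n
  · conv_lhs => rw [← hx, bpt_add_unitVec_of_lt n M y j ν h]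
    rw [edig_bpt, edig, Function.update_of_ne hν.symm]
  · have h' : (j ν : ℕ) + 1 = n := by have := (j ν).isLt; omega
    conv_lhs => rw [← hx, bpt_add_unitVec_of_eq n M y j ν h']
    rw [edig_bpt, edig, Function.update_of_ne hν.symm]

/-- … and `xstart (x + e_ν) = xstart x + e_ν`. [folklore] -/
theorem xstart_add_unitVec_ne (x : Tor (fine n M)) {ν : Fin d} (hν : ν ≠ e) :
    xstart n M e (x + unitVec (fine n M) ν) = xstart n M e x + unitVec (fine n M) ν := by
  rw [xstart, edig_add_unitVec_ne n M e x hν, xstart]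
  abel

/-- a first site: `edig x′ = 0 ⟹ xstart x′ = x′ − e`, i.e. `xstart x′ + e = x′`. [folklore] -/
theorem xstart_add_unitVec_of_edig_zero (x' : Tor (fine n M)) (h : edig n M e x' = 0) :
    xstart n M e x' + unitVec (fine n M) e = x' := by
  conv_rhs => rw [← xstart_add n M e x']
  rw [h, zero_add, tstep_one]

/-- the predecessor of a first site is the end of ITS OWN line shifted: if `edig x′ = 0` then
`xstart (x′ − e) + (n+1)·e = x′` (the site `x′ − e` is the last site of the preceding block). [folklore] -/
theorem xstart_sub_add_end (x' : Tor (fine n M)) (h : edig n M e x' = 0) :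
    xstart n M e (x' - unitVec (fine n M) e) + tstep (fine n M) e (n + 1) = x' := by
  -- `x′ − e = xstart x′` is the last site of block `blockOf x′ − e`
  have hx := bpt_blockOf_digits n M x'
  set y := blockOf n M x'
  set j := digits n M x'
  have hj : (j e : ℕ) = 0 := h
  have hj' : Function.update j e 0 = j := by
    funext ν
    by_cases hν : ν = e
    · subst hν; rw [Function.update_self]; exact Fin.ext (by rw [Fin.val_zero]; exact hj.symm)
    · rw [Function.update_of_ne hν]
  have e1 : x' - unitVec (fine n M) e = bpt n M (y - unitVec M e) (Function.update j e (lastD n)) := by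
    rw [sub_eq_iff_eq_add, ← bpt_update_zero_eq, hj', hx]
  rw [e1, xstart_bpt_add_tstep_end, sub_add_cancel, Function.update_idem, hj', hx]

/-- the `e`-digit of the predecessor of a first site is `n − 1`. [folklore] -/
theorem edig_sub_of_edig_zero (x' : Tor (fine n M)) (h : edig n M e x' = 0) :
    edig n M e (x' - unitVec (fine n M) e) + 1 = n := by
  have hx := bpt_blockOf_digits n M x'
  set y := blockOf n M x'
  set j := digits n M x'
  have hj : (j e : ℕ) = 0 := h
  have hj' : Function.update j e 0 = j := by
    funext ν
    by_cases hν : ν = e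
    · subst hν; rw [Function.update_self]; exact Fin.ext (by rw [Fin.val_zero]; exact hj.symm)
    · rw [Function.update_of_ne hν]
  have e1 : x' - unitVec (fine n M) e = bpt n M (y - unitVec M e) (Function.update j e (lastD n)) := by
    rw [sub_eq_iff_eq_add, ← bpt_update_zero_eq, hj', hx]
  rw [e1, edig_bpt, Function.update_self]
  show n - 1 + 1 = n
  have := Nat.pos_of_ne_zero (NeZero.ne n); omega

/-- if `edig (x + e) = 0`… rather: if `x + e` is a first site then `x` is a last site: `edig x + 1 = n`. [folklore] -/
theorem edig_succ_of_edig_add_zero (x : Tor (fine n M)) (h : edig n M e (x + unitVec (fine n M) e) = 0) : edig n M e x + 1 = n := by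
  have := edig_sub_of_edig_zero n M e (x + unitVec (fine n M) e) h
  rwa [add_sub_cancel_right] at this

/-- stepping back from a non-first site stays in the block: `edig z ≠ 0 ⟹ blockOf (z − e) = blockOf z`. [folklore] -/
theorem blockOf_sub_unitVec_e (z : Tor (fine n M)) (h : edig n M e z ≠ 0) :
    blockOf n M (z - unitVec (fine n M) e) = blockOf n M z := by
  have hz := bpt_blockOf_digits n M z
  set y := blockOf n M z
  set j := digits n M z
  have hj : (j e : ℕ) ≠ 0 := h
  have hlt : (j e : ℕ) - 1 < n := by have := (j e).isLt; omega
  have e1 : z - unitVec (fine n M) e = bpt n M y (Function.update j e ⟨(j e : ℕ) - 1, hlt⟩) := by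
    rw [sub_eq_iff_eq_add, ← bpt_update_add_tstep n M y j e ⟨_, hlt⟩, add_assoc, ← tstep_succ]
    simp only
    rw [show (j e : ℕ) - 1 + 1 = (j e : ℕ) by omega, ← bpt_eq_update_add n M y j e, hz]
  rw [e1, blockOf_bpt]

/-- moving along the line stays in the block: `edig x + 1 < n ⟹ blockOf (x + e) = blockOf x`. [folklore] -/
theorem blockOf_add_unitVec_e_of_lt (x : Tor (fine n M)) (h : edig n M e x + 1 < n) :
    blockOf n M (x + unitVec (fine n M) e) = blockOf n M x := by
  have hx := bpt_blockOf_digits n M x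
  have h' : ((digits n M x) e : ℕ) + 1 < n := h
  conv_lhs => rw [← hx, bpt_add_unitVec_of_lt n M _ _ e h', blockOf_bpt]

/-- leaving the block at the last site: `edig x + 1 = n ⟹ blockOf (x + e) = blockOf x + e`. [folklore] -/
theorem blockOf_add_unitVec_e_of_eq (x : Tor (fine n M)) (h : edig n M e x + 1 = n) :
    blockOf n M (x + unitVec (fine n M) e) = blockOf n M x + unitVec M e := by
  rw [add_unitVec_e_eq_end n M e x h, blockOf_xstart_add_tstep_end]

/-! ## §2 The line gauge and its `e`-residuals -/

variable (Z : Tor (fine n M) × Fin d → ℂ)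

/-- the PARTIAL LINE SUM `Σ_{s<k} Z(xstart x + s·e, e)` of the `e`-component along the line of `x`, from the exterior start. [folklore] -/
def pathSum (x : Tor (fine n M)) (k : ℕ) : ℂ := ∑ s ∈ range k, Z (xstart n M e x + tstep (fine n M) e s, e)

/-- the LINE MISMATCH `ℓ(x) = Σ_{s ≤ n} Z(xstart x + s·e, e)` — the full line integral over the `n + 1` `e`-bonds from the start site to the
first site of the next block (a gauge-invariant functional of the line for Dirichlet gauges). [folklore] -/
def ell (x : Tor (fine n M)) : ℂ := pathSum n M e Z x (n + 1)

/-- **THE LINE GAUGE** (torus version, before restriction to the region): `μ(x) = n⁻¹·Σ_{s ≤ edig x} Z(xstart x + s·e, e)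
− (edig x + 1)/(n(n+1))·ℓ(x)` — the integral of the field from the exterior start, the mismatch spread evenly over the `n + 1` bonds.
[folklore] -/
def muT (x : Tor (fine n M)) : ℂ :=
  (n : ℂ)⁻¹ * pathSum n M e Z x (edig n M e x + 1) - ((edig n M e x + 1 : ℕ) : ℂ) / ((n : ℂ) * ((n : ℂ) + 1)) * ell n M e Z x

/-- the CURL SUM `Σ_{s<k} F_{eν}(xstart x + s·e)` along the first `k` plaquettes of the line of `x` in the `(e,ν)`-plane
(`F_{eν} = Fs … (n:ℂ) Z e ν`, the entries of the tree's `CurlOp`). [cite: Balaban1984PropagatorsI, (1.2) p.18 (shape)] [folklore] -/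
def curlSum (ν : Fin d) (x : Tor (fine n M)) (k : ℕ) : ℂ :=
  ∑ s ∈ range k, Fs (fine n M) (n : ℂ) Z e ν (xstart n M e x + tstep (fine n M) e s)

variable {Z}

/-- one more bond: `pathSum x (k+1) = pathSum x k + Z(xstart x + k·e, e)`. [folklore] -/
theorem pathSum_succ (x : Tor (fine n M)) (k : ℕ) :
    pathSum n M e Z x (k + 1) = pathSum n M e Z x k + Z (xstart n M e x + tstep (fine n M) e k, e) := by
  rw [pathSum, sum_range_succ, pathSum]

/-- **THE `e`-RESIDUAL INSIDE A LINE**: for `edig x + 1 < n` (so `x + e` is the next site of the same block-line),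
`Z(x,e) − n·(μ(x + e) − μ(x)) = ℓ(x)/(n+1)`. [folklore] -/
theorem res_e_interior (x : Tor (fine n M)) (h : edig n M e x + 1 < n) :
    Z (x, e) - (n : ℂ) * (muT n M e Z (x + unitVec (fine n M) e) - muT n M e Z x) = ell n M e Z x / ((n : ℂ) + 1) := by
  have hn : (n : ℂ) ≠ 0 := by exact_mod_cast NeZero.ne n
  have hn1 : (n : ℂ) + 1 ≠ 0 := by exact_mod_cast Nat.succ_ne_zero n
  have hx : Z (x, e) = Z (xstart n M e x + tstep (fine n M) e (edig n M e x + 1), e) := by rw [xstart_add]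
  have hell : ell n M e Z (x + unitVec (fine n M) e) = ell n M e Z x := by
    rw [ell, ell, pathSum, pathSum, xstart_add_unitVec_e n M e x h]
  have hpath : pathSum n M e Z (x + unitVec (fine n M) e) (edig n M e (x + unitVec (fine n M) e) + 1)
      = pathSum n M e Z x (edig n M e x + 1) + Z (x, e) := by
    rw [edig_add_unitVec_e n M e x h, pathSum, xstart_add_unitVec_e n M e x h, ← pathSum, pathSum_succ, hx]
  rw [muT, muT, hell, hpath, edig_add_unitVec_e n M e x h]
  push_cast
  field_simp
  ring

/-- **THE `e`-RESIDUAL AT THE LAST SITE** (`edig x + 1 = n`; Dirichlet zero at `x + e`): `Z(x,e) + n·μ(x) = ℓ(x)/(n+1)`. [folklore] -/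
theorem res_e_last (x : Tor (fine n M)) (h : edig n M e x + 1 = n) :
    Z (x, e) + (n : ℂ) * muT n M e Z x = ell n M e Z x / ((n : ℂ) + 1) := by
  have hn : (n : ℂ) ≠ 0 := by exact_mod_cast NeZero.ne n
  have hn1 : (n : ℂ) + 1 ≠ 0 := by exact_mod_cast Nat.succ_ne_zero n
  have hx : Z (x, e) = Z (xstart n M e x + tstep (fine n M) e n, e) := by
    conv_lhs => rw [← xstart_add n M e x, h]
  have hell : ell n M e Z x = pathSum n M e Z x n + Z (x, e) := by rw [ell, pathSum_succ, hx]
  rw [muT, h, hell]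
  field_simp
  ring

/-- **THE `e`-RESIDUAL AT A FIRST SITE** (`edig x′ = 0`; Dirichlet zero at the start `xstart x′ = x′ − e`):
`Z(xstart x′, e) − n·μ(x′) = ℓ(x′)/(n+1)`. [folklore] -/
theorem res_e_first (x' : Tor (fine n M)) (h : edig n M e x' = 0) :
    Z (xstart n M e x', e) - (n : ℂ) * muT n M e Z x' = ell n M e Z x' / ((n : ℂ) + 1) := by
  have hn : (n : ℂ) ≠ 0 := by exact_mod_cast NeZero.ne n
  have hn1 : (n : ℂ) + 1 ≠ 0 := by exact_mod_cast Nat.succ_ne_zero n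
  have hpath : pathSum n M e Z x' (edig n M e x' + 1) = Z (xstart n M e x', e) := by
    rw [h, zero_add, pathSum_succ, pathSum, sum_range_zero, zero_add, tstep_zero, add_zero]
  rw [muT, hpath, h]
  push_cast
  field_simp
  ring

/-! ## §3 The transverse residual: plaquette telescoping along the line -/

/-- **PLAQUETTE TELESCOPING ALONG AN `e`-LINE**: for any start `b`, any `k`, any `ν`,
`Σ_{s<k} (Z(b + s·e + e_ν, e) − Z(b + s·e, e)) = Z(b + k·e, ν) − Z(b, ν) − n⁻¹·Σ_{s<k} F_{eν}(b + s·e)`, `F_{eν} = Fs … (n:ℂ) Z e ν`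
(each plaquette identity `F_{eν}(z) = n(Z(z,e) + Z(z+e,ν) − Z(z+e_ν,e) − Z(z,ν))`, summed; the `ν`-components telescope).
[cite: Balaban1984PropagatorsI, (1.2) p.18 (shape: the plaquette variable)] [folklore] -/
theorem tele_line (hn : (n : ℂ) ≠ 0) (b : Tor (fine n M)) (ν : Fin d) (k : ℕ) :
    ∑ s ∈ range k, (Z (b + tstep (fine n M) e s + unitVec (fine n M) ν, e) - Z (b + tstep (fine n M) e s, e))
      = Z (b + tstep (fine n M) e k, ν) - Z (b, ν)
        - (n : ℂ)⁻¹ * ∑ s ∈ range k, Fs (fine n M) (n : ℂ) Z e ν (b + tstep (fine n M) e s) := by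
  have hpl : ∀ s, Z (b + tstep (fine n M) e s + unitVec (fine n M) ν, e) - Z (b + tstep (fine n M) e s, e)
      = (Z (b + tstep (fine n M) e (s + 1), ν) - Z (b + tstep (fine n M) e s, ν))
        - (n : ℂ)⁻¹ * Fs (fine n M) (n : ℂ) Z e ν (b + tstep (fine n M) e s) := by
    intro s
    rw [Fs_apply, tstep_succ, ← add_assoc]
    field_simp
    ring
  rw [sum_congr rfl fun s _ => hpl s, sum_sub_distrib, sum_range_sub (fun s => Z (b + tstep (fine n M) e s, ν)) k, ← mul_sum,
    tstep_zero, add_zero]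

/-- the partial line sums of the translated line: `pathSum (x + e_ν) k = Σ_{s<k} Z(xstart x + s·e + e_ν, e)` (`ν ≠ e`). [folklore] -/
theorem pathSum_add_unitVec_ne (x : Tor (fine n M)) {ν : Fin d} (hν : ν ≠ e) (k : ℕ) :
    pathSum n M e Z (x + unitVec (fine n M) ν) k = ∑ s ∈ range k, Z (xstart n M e x + tstep (fine n M) e s + unitVec (fine n M) ν, e) := by
  rw [pathSum, xstart_add_unitVec_ne n M e x hν]
  refine sum_congr rfl fun s _ => ?_
  rw [add_right_comm]

/-- **THE MISMATCH OF THE TRANSLATED LINE**: under the two anchoring conditions, `ℓ(x + e_ν) − ℓ(x) = −n⁻¹·curlSum x (n+1)` (`ν ≠ e`)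
— the line mismatch is transversally Lipschitz with constant «one line of curls». [folklore] -/
theorem ell_add_unitVec_ne (x : Tor (fine n M)) {ν : Fin d} (hν : ν ≠ e) (h0 : Z (xstart n M e x, ν) = 0)
    (h1 : Z (xstart n M e x + tstep (fine n M) e (n + 1), ν) = 0) :
    ell n M e Z (x + unitVec (fine n M) ν) - ell n M e Z x = -((n : ℂ)⁻¹ * curlSum n M e Z ν x (n + 1)) := by
  have hn : (n : ℂ) ≠ 0 := by exact_mod_cast NeZero.ne n
  rw [ell, ell, pathSum_add_unitVec_ne n M e x hν, pathSum, ← sum_sub_distrib, tele_line n M e hn, h0, h1, sub_zero, zero_sub, curlSum]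

/-- the partial sums of the translated line, under the START anchoring condition only:
`pathSum (x + e_ν) (edig x + 1) − pathSum x (edig x + 1) = Z(x, ν) − n⁻¹·curlSum x (edig x + 1)` (`ν ≠ e`). [folklore] -/
theorem pathSum_add_unitVec_ne_sub (x : Tor (fine n M)) {ν : Fin d} (hν : ν ≠ e) (h0 : Z (xstart n M e x, ν) = 0) :
    pathSum n M e Z (x + unitVec (fine n M) ν) (edig n M e x + 1) - pathSum n M e Z x (edig n M e x + 1)
      = Z (x, ν) - (n : ℂ)⁻¹ * curlSum n M e Z ν x (edig n M e x + 1) := by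
  have hn : (n : ℂ) ≠ 0 := by exact_mod_cast NeZero.ne n
  rw [pathSum_add_unitVec_ne n M e x hν, pathSum, ← sum_sub_distrib, tele_line n M e hn, h0, sub_zero, xstart_add, curlSum]

/-- **THE TRANSVERSE RESIDUAL, EXACTLY**: if `ν ≠ e` and the two anchoring tangential bonds of the line of `x` carry no field,
`Z(xstart x, ν) = 0` and `Z(xstart x + (n+1)·e, ν) = 0`, then
`Z(x,ν) − n·(μ(x + e_ν) − μ(x)) = n⁻¹·curlSum x (edig x + 1) − (edig x + 1)/(n(n+1))·curlSum x (n+1)`. [folklore] -/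
theorem res_nu (x : Tor (fine n M)) {ν : Fin d} (hν : ν ≠ e) (h0 : Z (xstart n M e x, ν) = 0)
    (h1 : Z (xstart n M e x + tstep (fine n M) e (n + 1), ν) = 0) :
    Z (x, ν) - (n : ℂ) * (muT n M e Z (x + unitVec (fine n M) ν) - muT n M e Z x)
      = (n : ℂ)⁻¹ * curlSum n M e Z ν x (edig n M e x + 1)
        - ((edig n M e x + 1 : ℕ) : ℂ) / ((n : ℂ) * ((n : ℂ) + 1)) * curlSum n M e Z ν x (n + 1) := by
  have hn : (n : ℂ) ≠ 0 := by exact_mod_cast NeZero.ne n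
  have hn1 : (n : ℂ) + 1 ≠ 0 := by exact_mod_cast Nat.succ_ne_zero n
  set t := edig n M e x with ht
  -- the two telescoped differences
  have dpath : pathSum n M e Z (x + unitVec (fine n M) ν) (t + 1) - pathSum n M e Z x (t + 1)
      = Z (x, ν) - (n : ℂ)⁻¹ * curlSum n M e Z ν x (t + 1) := pathSum_add_unitVec_ne_sub n M e x hν h0
  have dell : ell n M e Z (x + unitVec (fine n M) ν) - ell n M e Z x = -((n : ℂ)⁻¹ * curlSum n M e Z ν x (n + 1)) :=
    ell_add_unitVec_ne n M e x hν h0 h1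
  have et : edig n M e (x + unitVec (fine n M) ν) = t := edig_add_unitVec_ne n M e x hν
  -- expand `μ` at both sites and substitute
  have key : (n : ℂ) * (muT n M e Z (x + unitVec (fine n M) ν) - muT n M e Z x)
      = (pathSum n M e Z (x + unitVec (fine n M) ν) (t + 1) - pathSum n M e Z x (t + 1))
        - ((t + 1 : ℕ) : ℂ) / ((n : ℂ) + 1) * (ell n M e Z (x + unitVec (fine n M) ν) - ell n M e Z x) := by
    rw [muT, muT, et]
    field_simp
    ring
  rw [key, dpath, dell]
  push_cast
  field_simp
  ring

end Summit.QuantumFields.BalabanUV.T4Continuum.RegionStarLineGauge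

end
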